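import Mathlib
import HarnessLib
import Literature.NumberTheory.Transcendental.KZKernelConjectureForms
import Summits.KontsevichZagierPeriods.KontsevichZagierPeriods.Theses.LinRedNormalForm

/-!
# Route LinRedNormalForm, item `HyperlogKernelInKZ` (stmt-KontsevichZagierPeriods-14821): strength of the declared sector kernel

The support item `HyperlogKernelInKZ` of route LinRedNormalForm ("every `ℤ`-combination of
hyperlogarithm word representations `[Δ_w, q·∏ᵢ (tᵢ − aᵢ)⁻¹]` — open ordered simplex, rational
letters `aᵢ`, `q ∈ ℚ` — whose value is `0` lies in `KZ.relations`") is the route's DECLARED SECTOR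
KERNEL on the arrangement sector: it is the kernel form of Conjecture 1 of Kontsevich–Zagier
(`Literature.NumberTheory.Transcendental.KZKernelConjecture`, `ker eval = relations`, OPEN)
restricted to the subgroup generated by the hyperlogarithm word representations. This file records,
sorry-free, exactly where it sits:

* `hyperlogKernelInKZ_of_kzKernelConjecture`, `hyperlogKernelInKZ_of_kontsevichZagierPeriods` —
  UPPER BOUND: the kernel conjecture, hence the summit statement `KontsevichZagierPeriods` itself
  (kernel form ⇔ KZ-literal form, `kzKernelConjecture_iff_isRational`), implies it; so a proof of
  `¬ HyperlogKernelInKZ` would refute the summit;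
* `mzvWordReps_subset_hyperlogWordReps`, `mzvKernelInKZ_of_hyperlogKernelInKZ` — LOWER BOUND: an
  MZV word representation `[Δ_w, q·∏ᵢ ω_{εᵢ}(tᵢ)]` (`ω₀ = 1/t`, `ω₁ = 1/(1−t)`) IS a hyperlogarithm
  word representation (letters `aᵢ = [εᵢ] ∈ {0,1}`, constant `q·∏ᵢ (εᵢ ? −1 : 1)`, since
  `1/(1−t) = −1/(t−1)`), so the item implies the route's crux `MzvKernelInKZ` (item 3914, the kernel
  on MZV word representations, whose only known proof shape needs Zagier-conjecture-level
  transcendence input); in particular `KontsevichZagierPeriods → MzvKernelInKZ`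
  (`mzvKernelInKZ_of_kontsevichZagierPeriods`);
* `hyperlogWordReps_subset_arrangementReps` — a hyperlogarithm word representation IS an
  arrangement representation in the sense of the crux `ArrangementNormalForm` (the open ordered
  simplex is the rational polyhedral cell cut out by the `w + w + w·w` affine forms `tᵢ`, `1 − tᵢ`,
  `tᵢ − tⱼ (i<j)` (padded by the constant form `1`), and `q·∏ᵢ (tᵢ − aᵢ)⁻¹ = C q / ∏ⱼ Lⱼ¹` with
  `Lⱼ = tⱼ − aⱼ`); hence `hyperlogKernelInKZ_of_arrangementKernel` (the kernel on the arrangement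
  sector implies the item, unconditionally) and, granted the crux `ArrangementNormalForm`,
  `arrangementKernel_of_hyperlogKernelInKZ` / `hyperlogKernelInKZ_iff_arrangementKernel`: the item
  IS the kernel conjecture on the arrangement sector, and `arrangementSector_of_hyperlogKernelInKZ`:
  Conjecture 1 for pairs of arrangement representations (the arrangement analogue of the route's
  `SectorGlue`). This is the precise sense of the planner's phrase "the ARITHMETIC complement of
  crux ArrangementNormalForm".

Consequently neither `HyperlogKernelInKZ` nor its negation is accessible short of settling the
Kontsevich–Zagier period conjecture on the arrangement / mixed-Tate sector: its instances include
every `ℚ`-linear relation among multiple polylogarithms at rational arguments (e.g. on the family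
`n₀·[pt, 1] + n₁·[Δ₅, 1/(t₀t₁t₂t₃(1−t₄))]`, value `n₀ + n₁ζ(5)`, it already needs the irrationality
of `ζ(5)` (open) or a move chain certifying a rational value), and a refutation would be an additive
move-invariant separating two equal-valued hyperlogarithm combinations, i.e. a refutation of the
summit (route Neg, `NegObstructionShape`).

No definition is introduced: the three generator sets (MZV words, hyperlogarithm words,
arrangement representations) are written out verbatim as in the route decls `MzvKernelInKZ`,
`HyperlogKernelInKZ`, `ArrangementNormalForm`.

References: M. Kontsevich, D. Zagier, *Periods* (2001), §1.2, Conjecture 1; A. Huber,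
S. Müller-Stach, *Periods and Nori Motives* (2017), Conj. 13.2.1 (kernel form); A. B. Goncharov,
*Multiple polylogarithms and mixed Tate motives* (arXiv:math/0103059), §1 (hyperlogarithms with
rational letters as periods of mixed Tate motives); F. Brown, *Mixed Tate motives over ℤ*,
Ann. Math. 175 (2012) (the case of letters `{0,1}`).
-/

noncomputable section

namespace Summit.KontsevichZagierPeriods.HyperlogKernelInKZ

open Literature.NumberTheory.Transcendental
open Summit.KontsevichZagierPeriods.KontsevichZagierPeriods.Theses.LinRedNormalForm

/-! ### Upper bound: the kernel conjecture (hence the summit) implies the item -/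

/-- **Kernel conjecture ⇒ sector kernel.** If `ker eval = relations`
(`Literature.NumberTheory.Transcendental.KZKernelConjecture`, the kernel form of Conjecture 1 of
Kontsevich–Zagier 2001, §1.2 — an OPEN conjecture, taken here as a hypothesis), then in particular
every vanishing `ℤ`-combination of hyperlogarithm word representations is a relation. [folklore] -/
theorem hyperlogKernelInKZ_of_kzKernelConjecture (hK : KZKernelConjecture) :
    HyperlogKernelInKZ :=
  fun c _ hc => hK c hc

/-- **Summit ⇒ sector kernel.** The summit statement `KontsevichZagierPeriods` (Conjecture 1 with
KZ-literal rational endpoints) is equivalent to the kernel form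
(`Literature.NumberTheory.Transcendental.kzKernelConjecture_iff_isRational`, proved in tree), hence
implies the declared sector kernel. In particular a refutation of `HyperlogKernelInKZ` would refute
the summit. [folklore] -/
theorem hyperlogKernelInKZ_of_kontsevichZagierPeriods (h : KontsevichZagierPeriods) :
    HyperlogKernelInKZ :=
  hyperlogKernelInKZ_of_kzKernelConjecture (kzKernelConjecture_iff_isRational.mpr h)

/-! ### Lower bound: the item contains the crux `MzvKernelInKZ` -/

/-- The MZV letters are hyperlogarithm letters: `ω₁(x) = 1/(1−x) = (−1)·1/(x−1)` and
`ω₀(x) = 1/x = 1·1/(x−0)`, with the letter `[ε] ∈ {0,1} ⊆ ℚ` and the sign `(ε ? −1 : 1) ∈ ℚ`.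
[folklore] -/
theorem mzvLetter_eq_sign_mul_hyperlogLetter (ε : Bool) (x : ℝ) :
    (if ε then 1 / (1 - x) else 1 / x) =
      ((if ε then -1 else 1 : ℚ) : ℝ) * (1 / (x - ((if ε then 1 else 0 : ℚ) : ℝ))) := by
  cases ε
  · simp
  · simp only [if_true, Rat.cast_neg, Rat.cast_one, neg_mul, one_mul, one_div]
    rw [neg_inv, neg_sub]

/-- **MZV word representations are hyperlogarithm word representations.** The generator set of
`MzvKernelInKZ` / `DihedralNormalForm` (representations on the open ordered simplex with integrand
`q·∏ᵢ ω_{εᵢ}(tᵢ)` on it) is contained in the generator set of `HyperlogKernelInKZ` /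
`ArrangementNormalForm` (integrand `q'·∏ᵢ (tᵢ − aᵢ)⁻¹`, `aᵢ ∈ ℚ`): take `aᵢ = [εᵢ]` and
`q' = q·∏ᵢ (εᵢ ? −1 : 1)`. [folklore] -/
theorem mzvWordReps_subset_hyperlogWordReps :
    {x : KZ.FormalRep | ∃ (w : ℕ) (ε : Fin w → Bool) (q : ℚ) (s : KZ.IntegralRep w),
        s.domain = {t | (∀ i, 0 < t i) ∧ (∀ i, t i < 1) ∧ StrictAnti t} ∧
        Set.EqOn s.integrand (fun t => (q : ℝ) * ∏ i, if ε i then 1 / (1 - t i) else 1 / t i)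
          s.domain ∧ x = KZ.of s} ⊆
    {y : KZ.FormalRep | ∃ (w : ℕ) (a : Fin w → ℚ) (q : ℚ) (s : KZ.IntegralRep w),
        s.domain = {t | (∀ i, 0 < t i) ∧ (∀ i, t i < 1) ∧ StrictAnti t} ∧
        Set.EqOn s.integrand (fun t => (q : ℝ) * ∏ i, 1 / (t i - (a i : ℝ))) s.domain ∧
        y = KZ.of s} := by
  rintro x ⟨w, ε, q, s, hdom, hint, rfl⟩
  refine ⟨w, fun i => if ε i then 1 else 0, q * ∏ i, (if ε i then -1 else 1), s, hdom, ?_, rfl⟩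
  intro t ht
  refine (hint ht).trans ?_
  simp only []
  rw [Finset.prod_congr rfl fun i _ => mzvLetter_eq_sign_mul_hyperlogLetter (ε i) (t i),
    Finset.prod_mul_distrib, Rat.cast_mul, Rat.cast_prod, mul_assoc]

/-- **Sector kernel ⇒ MZV kernel.** `HyperlogKernelInKZ → MzvKernelInKZ`: the subgroup generated
by the MZV word representations is contained in the one generated by the hyperlogarithm word
representations (`AddSubgroup.closure_mono` on `mzvWordReps_subset_hyperlogWordReps`), so the
kernel statement restricts. Thus the item contains the route's crux `MzvKernelInKZ` (item 3914).
[folklore] -/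
theorem mzvKernelInKZ_of_hyperlogKernelInKZ (h : HyperlogKernelInKZ) : MzvKernelInKZ :=
  fun c hc hev => h c (AddSubgroup.closure_mono mzvWordReps_subset_hyperlogWordReps hc) hev

/-- **Summit ⇒ MZV kernel**, through the sector kernel: `KontsevichZagierPeriods → MzvKernelInKZ`.
[folklore] -/
theorem mzvKernelInKZ_of_kontsevichZagierPeriods (h : KontsevichZagierPeriods) : MzvKernelInKZ :=
  mzvKernelInKZ_of_hyperlogKernelInKZ (hyperlogKernelInKZ_of_kontsevichZagierPeriods h)

/-! ### The item inside the arrangement sector -/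

/-- A coordinate row: `∑ₖ [k = i]·xₖ = xᵢ` (the rational row `Pi.single i 1` read in `ℝ`).
[folklore] -/
theorem sum_cast_single_mul {w : ℕ} (i : Fin w) (x : Fin w → ℝ) :
    ∑ k, ((Pi.single i (1 : ℚ) : Fin w → ℚ) k : ℝ) * x k = x i := by
  rw [Finset.sum_eq_single i]
  · simp
  · intro k _ hk
    simp [Pi.single_eq_of_ne hk]
  · simp

/-- **Hyperlogarithm word representations are arrangement representations.** The generator set of
`HyperlogKernelInKZ` is contained in the class of representations normalised by the crux
`ArrangementNormalForm`: the open ordered simplex `{1 > t₀ > ⋯ > t_{w−1} > 0}` is the open rational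
polyhedral cell `{x | ∀ j, 0 < Mⱼ·x + mⱼ}` for the `w + w + w·w` rows `tᵢ` (`i < w`), `1 − tᵢ`
(`i < w`), and, for `(i, j) ∈ w × w`, `tᵢ − tⱼ` if `i < j` and the constant `1` otherwise (rows
transported along `(Fin w ⊕ Fin w) ⊕ (Fin w × Fin w) ≃ Fin (w + w + w·w)`); and on it
`q·∏ᵢ (tᵢ − aᵢ)⁻¹ = (C q)(t) / ∏ⱼ Lⱼ(t)¹` for the affine forms `Lⱼ = tⱼ − aⱼ`. [folklore] -/
theorem hyperlogWordReps_subset_arrangementReps :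
    {y : KZ.FormalRep | ∃ (w : ℕ) (a : Fin w → ℚ) (q : ℚ) (s : KZ.IntegralRep w),
        s.domain = {t | (∀ i, 0 < t i) ∧ (∀ i, t i < 1) ∧ StrictAnti t} ∧
        Set.EqOn s.integrand (fun t => (q : ℝ) * ∏ i, 1 / (t i - (a i : ℝ))) s.domain ∧
        y = KZ.of s} ⊆
    {y : KZ.FormalRep | ∃ (n m m' : ℕ) (r : KZ.IntegralRep n) (M : Fin m' → (Fin n → ℚ) × ℚ)
        (L : Fin m → (Fin n → ℚ) × ℚ) (e : Fin m → ℕ) (p : MvPolynomial (Fin n) ℚ),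
        r.domain = {x | ∀ j, 0 < ∑ i, ((M j).1 i : ℝ) * x i + ((M j).2 : ℝ)} ∧
        Set.EqOn r.integrand (fun x => MvPolynomial.aeval x p /
          ∏ j, (∑ i, ((L j).1 i : ℝ) * x i + ((L j).2 : ℝ)) ^ e j) r.domain ∧
        y = KZ.of r} := by
  rintro y ⟨w, a, q, s, hdom, hint, rfl⟩
  -- the rows of the simplex cell, indexed by a sum type, and their transport to `Fin (w + w + w*w)`
  let R : (Fin w ⊕ Fin w) ⊕ (Fin w × Fin w) → (Fin w → ℚ) × ℚ :=
    Sum.elim (Sum.elim (fun i => (Pi.single i 1, 0)) (fun i => (-Pi.single i 1, 1)))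
      (fun p => if p.1 < p.2 then (Pi.single p.1 1 - Pi.single p.2 1, 0) else (0, 1))
  let e : (Fin w ⊕ Fin w) ⊕ (Fin w × Fin w) ≃ Fin (w + w + w * w) :=
    (Equiv.sumCongr finSumFinEquiv finProdFinEquiv).trans finSumFinEquiv
  -- the value of each row
  have hrow : ∀ (x : Fin w → ℝ) (k : (Fin w ⊕ Fin w) ⊕ (Fin w × Fin w)),
      ∑ i, ((R k).1 i : ℝ) * x i + ((R k).2 : ℝ) =
        Sum.elim (Sum.elim (fun i => x i) (fun i => 1 - x i))
          (fun p => if p.1 < p.2 then x p.1 - x p.2 else 1) k := by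
    intro x k
    rcases k with ((i | i) | ⟨i, j⟩)
    · simp only [R, Sum.elim_inl, Rat.cast_zero, add_zero]
      exact sum_cast_single_mul i x
    · simp only [R, Sum.elim_inl, Sum.elim_inr, Pi.neg_apply, Rat.cast_neg, neg_mul,
        Finset.sum_neg_distrib, Rat.cast_one, sum_cast_single_mul]
      ring
    · simp only [R, Sum.elim_inr]
      split_ifs with hij
      · simp only [Pi.sub_apply, Rat.cast_sub, sub_mul, Finset.sum_sub_distrib,
          sum_cast_single_mul, Rat.cast_zero, add_zero]
      · simp
  refine ⟨w, w, w + w + w * w, s, fun j => R (e.symm j), fun j => (Pi.single j 1, -a j),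
    fun _ => 1, MvPolynomial.C q, ?_, ?_, rfl⟩
  · -- the open ordered simplex is the cell of the rows
    rw [hdom]
    ext x
    simp only [Set.mem_setOf_eq]
    constructor
    · rintro ⟨hpos, hlt, hanti⟩ j
      rw [hrow x (e.symm j)]
      rcases e.symm j with ((i | i) | ⟨i, i'⟩)
      · exact hpos i
      · simpa using hlt i
      · simp only [Sum.elim_inr]
        split_ifs with hii'
        · exact sub_pos.mpr (hanti hii')
        · exact one_pos
    · intro h
      have h' : ∀ k, 0 < ∑ i, ((R k).1 i : ℝ) * x i + ((R k).2 : ℝ) := fun k => by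
        simpa using h (e k)
      refine ⟨fun i => ?_, fun i => ?_, fun i i' hii' => ?_⟩
      · simpa [hrow] using h' (Sum.inl (Sum.inl i))
      · simpa [hrow] using h' (Sum.inl (Sum.inr i))
      · have := h' (Sum.inr (i, i'))
        rw [hrow] at this
        simpa [hii'] using this
  · -- the integrand is `C q / ∏ⱼ (tⱼ − aⱼ)¹`
    intro x hx
    rw [hint hx]
    simp only [MvPolynomial.aeval_C, eq_ratCast, Rat.cast_neg, pow_one, sum_cast_single_mul,
      ← sub_eq_add_neg, one_div]
    rw [Finset.prod_inv_distrib, div_eq_mul_inv]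

/-- **Arrangement kernel ⇒ sector kernel** (unconditional). If every vanishing `ℤ`-combination of
arrangement representations (open rational polyhedral cell, integrand `P/∏ⱼ Lⱼ^{eⱼ}` with rational
affine forms `Lⱼ` — verbatim the hypotheses of the crux `ArrangementNormalForm`) is a relation,
then so is every vanishing combination of hyperlogarithm word representations, these being
arrangement representations (`hyperlogWordReps_subset_arrangementReps`, `AddSubgroup.closure_mono`).
[folklore] -/
theorem hyperlogKernelInKZ_of_arrangementKernel
    (hA : ∀ c ∈ AddSubgroup.closure
      {y : KZ.FormalRep | ∃ (n m m' : ℕ) (r : KZ.IntegralRep n) (M : Fin m' → (Fin n → ℚ) × ℚ)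
        (L : Fin m → (Fin n → ℚ) × ℚ) (e : Fin m → ℕ) (p : MvPolynomial (Fin n) ℚ),
        r.domain = {x | ∀ j, 0 < ∑ i, ((M j).1 i : ℝ) * x i + ((M j).2 : ℝ)} ∧
        Set.EqOn r.integrand (fun x => MvPolynomial.aeval x p /
          ∏ j, (∑ i, ((L j).1 i : ℝ) * x i + ((L j).2 : ℝ)) ^ e j) r.domain ∧
        y = KZ.of r}, KZ.eval c = 0 → c ∈ KZ.relations) :
    HyperlogKernelInKZ :=
  fun c hc hev => hA c (AddSubgroup.closure_mono hyperlogWordReps_subset_arrangementReps hc) hev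

/-- **Granted the normal form, sector kernel ⇒ arrangement kernel.** Under the crux
`ArrangementNormalForm` (every arrangement representation is congruent modulo `KZ.relations` to a
`ℤ`-combination of hyperlogarithm word representations; OPEN, taken as a hypothesis), the declared
sector kernel gives the kernel on the whole arrangement sector: extend the normal form additively
over `AddSubgroup.closure` to get `m` in the closure of the hyperlogarithm words with
`c − m ∈ relations`; soundness (`KZ.relations_le_ker_eval_holds`) gives `eval m = eval c = 0`, so
`m ∈ relations` by `HyperlogKernelInKZ`, and `c = (c − m) + m`. [folklore] -/
theorem arrangementKernel_of_hyperlogKernelInKZ (hNF : ArrangementNormalForm)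
    (h : HyperlogKernelInKZ) :
    ∀ c ∈ AddSubgroup.closure
      {y : KZ.FormalRep | ∃ (n m m' : ℕ) (r : KZ.IntegralRep n) (M : Fin m' → (Fin n → ℚ) × ℚ)
        (L : Fin m → (Fin n → ℚ) × ℚ) (e : Fin m → ℕ) (p : MvPolynomial (Fin n) ℚ),
        r.domain = {x | ∀ j, 0 < ∑ i, ((M j).1 i : ℝ) * x i + ((M j).2 : ℝ)} ∧
        Set.EqOn r.integrand (fun x => MvPolynomial.aeval x p /
          ∏ j, (∑ i, ((L j).1 i : ℝ) * x i + ((L j).2 : ℝ)) ^ e j) r.domain ∧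
        y = KZ.of r}, KZ.eval c = 0 → c ∈ KZ.relations := by
  intro c hc hev
  -- additive extension of the generator-wise normal form to the generated subgroup
  have hext : ∀ c ∈ AddSubgroup.closure
      {y : KZ.FormalRep | ∃ (n m m' : ℕ) (r : KZ.IntegralRep n) (M : Fin m' → (Fin n → ℚ) × ℚ)
        (L : Fin m → (Fin n → ℚ) × ℚ) (e : Fin m → ℕ) (p : MvPolynomial (Fin n) ℚ),
        r.domain = {x | ∀ j, 0 < ∑ i, ((M j).1 i : ℝ) * x i + ((M j).2 : ℝ)} ∧
        Set.EqOn r.integrand (fun x => MvPolynomial.aeval x p /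
          ∏ j, (∑ i, ((L j).1 i : ℝ) * x i + ((L j).2 : ℝ)) ^ e j) r.domain ∧
        y = KZ.of r},
      ∃ m ∈ AddSubgroup.closure
      {y : KZ.FormalRep | ∃ (w : ℕ) (a : Fin w → ℚ) (q : ℚ) (s : KZ.IntegralRep w),
        s.domain = {t | (∀ i, 0 < t i) ∧ (∀ i, t i < 1) ∧ StrictAnti t} ∧
        Set.EqOn s.integrand (fun t => (q : ℝ) * ∏ i, 1 / (t i - (a i : ℝ))) s.domain ∧
        y = KZ.of s}, c - m ∈ KZ.relations := by
    intro c hc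
    induction hc using AddSubgroup.closure_induction with
    | mem x hx =>
      obtain ⟨n, m, m', r, M, L, e, p, hdom, hint, rfl⟩ := hx
      exact hNF n m m' r M L e p hdom hint
    | zero => exact ⟨0, zero_mem _, by simp⟩
    | add x y _ _ ihx ihy =>
      obtain ⟨m₁, hm₁, h₁⟩ := ihx
      obtain ⟨m₂, hm₂, h₂⟩ := ihy
      refine ⟨m₁ + m₂, add_mem hm₁ hm₂, ?_⟩
      have key := add_mem h₁ h₂
      rwa [show x - m₁ + (y - m₂) = x + y - (m₁ + m₂) by abel] at key
    | neg x _ ih =>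
      obtain ⟨m, hm, h⟩ := ih
      refine ⟨-m, neg_mem hm, ?_⟩
      have key := neg_mem h
      rwa [show -(x - m) = -x - -m by abel] at key
  obtain ⟨m, hm, hcm⟩ := hext c hc
  have hsound : KZ.eval (c - m) = 0 :=
    (AddMonoidHom.mem_ker).1 (KZ.relations_le_ker_eval_holds hcm)
  rw [map_sub, hev, zero_sub, neg_eq_zero] at hsound
  have key := add_mem hcm (h m hm hsound)
  rwa [sub_add_cancel] at key

/-- **Granted the normal form, the item IS the kernel conjecture on the arrangement sector.**
Under `ArrangementNormalForm` (OPEN crux, hypothesis), `HyperlogKernelInKZ` is equivalent to the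
statement that every vanishing `ℤ`-combination of arrangement representations is a relation
(`arrangementKernel_of_hyperlogKernelInKZ`, `hyperlogKernelInKZ_of_arrangementKernel`). This is
the precise sense in which the item is "the arithmetic complement of `ArrangementNormalForm`".
[folklore] -/
theorem hyperlogKernelInKZ_iff_arrangementKernel (hNF : ArrangementNormalForm) :
    HyperlogKernelInKZ ↔
      ∀ c ∈ AddSubgroup.closure
      {y : KZ.FormalRep | ∃ (n m m' : ℕ) (r : KZ.IntegralRep n) (M : Fin m' → (Fin n → ℚ) × ℚ)
        (L : Fin m → (Fin n → ℚ) × ℚ) (e : Fin m → ℕ) (p : MvPolynomial (Fin n) ℚ),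
        r.domain = {x | ∀ j, 0 < ∑ i, ((M j).1 i : ℝ) * x i + ((M j).2 : ℝ)} ∧
        Set.EqOn r.integrand (fun x => MvPolynomial.aeval x p /
          ∏ j, (∑ i, ((L j).1 i : ℝ) * x i + ((L j).2 : ℝ)) ^ e j) r.domain ∧
        y = KZ.of r}, KZ.eval c = 0 → c ∈ KZ.relations :=
  ⟨arrangementKernel_of_hyperlogKernelInKZ hNF, hyperlogKernelInKZ_of_arrangementKernel⟩

/-- **Granted the normal form, the item gives Conjecture 1 on the arrangement sector** (the
arrangement analogue of the route's `SectorGlue`): under `ArrangementNormalForm` (OPEN crux,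
hypothesis) and `HyperlogKernelInKZ`, two arrangement representations `r`, `r'` (open rational
polyhedral cells, integrands `P/∏ⱼ Lⱼ^{eⱼ}`, possibly of different dimensions) with the same value
are KZ-equivalent: `[r] − [r']` is a vanishing combination of arrangement representations
(`map_sub`, `KZ.eval_of`), hence a relation by `arrangementKernel_of_hyperlogKernelInKZ`.
[folklore] -/
theorem arrangementSector_of_hyperlogKernelInKZ (hNF : ArrangementNormalForm)
    (h : HyperlogKernelInKZ) :
    ∀ (n m m' n' k k' : ℕ) (r : KZ.IntegralRep n) (r' : KZ.IntegralRep n')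
      (M : Fin m' → (Fin n → ℚ) × ℚ) (L : Fin m → (Fin n → ℚ) × ℚ) (e : Fin m → ℕ)
      (p : MvPolynomial (Fin n) ℚ)
      (M' : Fin k' → (Fin n' → ℚ) × ℚ) (L' : Fin k → (Fin n' → ℚ) × ℚ) (e' : Fin k → ℕ)
      (p' : MvPolynomial (Fin n') ℚ),
      r.domain = {x | ∀ j, 0 < ∑ i, ((M j).1 i : ℝ) * x i + ((M j).2 : ℝ)} →
      Set.EqOn r.integrand (fun x => MvPolynomial.aeval x p /
        ∏ j, (∑ i, ((L j).1 i : ℝ) * x i + ((L j).2 : ℝ)) ^ e j) r.domain →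
      r'.domain = {x | ∀ j, 0 < ∑ i, ((M' j).1 i : ℝ) * x i + ((M' j).2 : ℝ)} →
      Set.EqOn r'.integrand (fun x => MvPolynomial.aeval x p' /
        ∏ j, (∑ i, ((L' j).1 i : ℝ) * x i + ((L' j).2 : ℝ)) ^ e' j) r'.domain →
      r.value = r'.value → KZ.Equivalent r r' := by
  intro n m m' n' k k' r r' M L e p M' L' e' p' hdom hint hdom' hint' hv
  refine arrangementKernel_of_hyperlogKernelInKZ hNF h (KZ.of r - KZ.of r')
    (sub_mem (AddSubgroup.subset_closure ⟨n, m, m', r, M, L, e, p, hdom, hint, rfl⟩)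
      (AddSubgroup.subset_closure ⟨n', k, k', r', M', L', e', p', hdom', hint', rfl⟩)) ?_
  rw [map_sub, KZ.eval_of, KZ.eval_of, hv, sub_self]

end Summit.KontsevichZagierPeriods.HyperlogKernelInKZ
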